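import Literature.NumberTheory.LFunctions.WeilLineSupSampling
import Literature.NumberTheory.LFunctions.MertensConjectureDisproof
import HarnessLib

/-!
# T73 — verified zeros are finite-rank information for the window Weil form

For a Weil test `g` and `z ∈ ℂ` the first-order ANNIHILATOR
`A_z g = g' + (z - 1/2) g` is again a Weil test with the same support, its transform is
`(A_z g)^(s) = (z - s) ĝ(s)` (`weilMellin_weilAnnihilate`, from `(g')^ = -(s - 1/2) ĝ`), and
`A_z g ≠ 0` whenever `g ≠ 0` (`weilAnnihilate_ne_zero`: a compactly supported solution of
`g' = c g` vanishes, by `is_const_of_deriv_eq_zero` applied to `g e^{-ct}`).  Iterating over a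
finite set (`exists_isWeilTest_weilMellin_eq_zero_on_finset`):

  for every `a > 0` and every finite `S ⊂ ℂ` there is a nonzero Weil test `g` supported in
  `[-a, a]` with `ĝ(z) = 0` for all `z ∈ S`.

In particular (`exists_isWeilTest_weilMellin_eq_zero_on_zetaZerosBelow`), for every window
`a > 0` and every height `T₀` there is a nonzero window-`a` test whose transform vanishes at EVERY
zero of `ζ` in the critical strip with `|Im ρ| < T₀`, so that every weighted "verified part" of the
zero side of the explicit formula, `∑_{ρ verified} m(ρ) |ĝ(ρ)|²`, vanishes for it
(`verified_zero_sum_eq_zero`).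

Use (s22, sharpest §2 (D9)(xi) / audit-s22 P3): the zero-side content of a numerical verification
`RHUpTo T₀` is a positive form of FINITE RANK on the infinite-dimensional window space, with a
nontrivial kernel on every window; hence no "frame bound at the verified zeros" can exist, and the
sign of the window ground energy `ε(a)` is decided, on every window, by the unverified zeros together
with the archimedean term.  This converts "not available" (T42 discussion) into "cannot exist".
-/

open Complex Set Filter MeasureTheory Literature.NumberTheory.LFunctions
open scoped Real Topology

namespace Summit.RiemannHypothesis.RiemannHypothesis.Theorems

variable {g : ℝ → ℂ} {a : ℝ}

/-- The first-order annihilator `A_z g = g' + (z - 1/2) g`. -/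
noncomputable def weilAnnihilate (g : ℝ → ℂ) (z : ℂ) : ℝ → ℂ :=
  deriv g + fun t ↦ (z - 1 / 2) * g t

/-- Pointwise form of the annihilator. -/
theorem weilAnnihilate_apply (g : ℝ → ℂ) (z : ℂ) (t : ℝ) :
    weilAnnihilate g z t = deriv g t + (z - 1 / 2) * g t := rfl

/-- `A_z g` is a Weil test. -/
theorem isWeilTest_weilAnnihilate (hg : IsWeilTest g) (z : ℂ) :
    IsWeilTest (weilAnnihilate g z) :=
  hg.deriv.add (hg.const_mul (z - 1 / 2))

/-- `A_z` does not enlarge the support. -/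
theorem tsupport_weilAnnihilate_subset (g : ℝ → ℂ) (z : ℂ) :
    tsupport (weilAnnihilate g z) ⊆ tsupport g :=
  (tsupport_add _ _).trans (union_subset tsupport_deriv_subset
    (tsupport_mul_subset_right (f := fun _ : ℝ ↦ (z - 1 / 2 : ℂ)) (g := g)))

/-- `(A_z g)^(s) = (z - s) ĝ(s)`. -/
theorem weilMellin_weilAnnihilate (hg : IsWeilTest g) (z s : ℂ) :
    weilMellin (weilAnnihilate g z) s = (z - s) * weilMellin g s := by
  have hd : IsWeilTest (deriv g) := hg.deriv
  have hc : IsWeilTest fun t ↦ (z - 1 / 2) * g t := hg.const_mul _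
  unfold weilAnnihilate
  rw [weilMellin_add hd.1.continuous hd.2 hc.1.continuous hc.2, weilMellin_const_mul,
    weilMellin_deriv hg]
  ring

/-- `(A_z g)^(z) = 0`. -/
theorem weilMellin_weilAnnihilate_self (hg : IsWeilTest g) (z : ℂ) :
    weilMellin (weilAnnihilate g z) z = 0 := by
  rw [weilMellin_weilAnnihilate hg, sub_self, zero_mul]

/-- A compactly supported test killed by `A_z` vanishes: `g' = -(z - 1/2) g` forces
`g e^{(z - 1/2) t}` to be constant, and the constant is read off outside the support. -/
theorem weilAnnihilate_ne_zero (hg : IsWeilTest g) (hga : tsupport g ⊆ Icc (-a) a) (hg0 : g ≠ 0)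
    (z : ℂ) : weilAnnihilate g z ≠ 0 := by
  intro hA
  apply hg0
  set c : ℂ := z - 1 / 2 with hc
  have hode : ∀ t, deriv g t = -c * g t := by
    intro t
    have := congr_fun hA t
    simp only [weilAnnihilate_apply, Pi.zero_apply] at this
    linear_combination this
  -- `F t = g t * exp (c t)` has zero derivative
  have hgd : ∀ t : ℝ, HasDerivAt g (deriv g t) t := fun t ↦
    (hg.1.differentiable (by simp) t).hasDerivAt
  have hexp : ∀ t : ℝ, HasDerivAt (fun t : ℝ ↦ cexp (c * t)) (c * cexp (c * t)) t := by
    intro t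
    have h1 : HasDerivAt (fun t : ℝ ↦ c * (t : ℂ)) (c * 1) t :=
      (Complex.ofRealCLM.hasDerivAt.const_mul c).congr_deriv (by simp)
    have h2 := (Complex.hasDerivAt_exp (c * t)).comp t h1
    simpa [mul_comm, Function.comp_def] using h2
  have hF : ∀ t : ℝ, HasDerivAt (fun t : ℝ ↦ g t * cexp (c * t)) 0 t := by
    intro t
    have h3 := (hgd t).mul (hexp t)
    rw [hode t] at h3
    have h0 : -c * g t * cexp (c * t) + g t * (c * cexp (c * t)) = 0 := by ring
    rwa [h0] at h3
  have hconst : ∀ t : ℝ, g t * cexp (c * t) = g (a + 1) * cexp (c * (a + 1 : ℝ)) := fun t ↦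
    is_const_of_deriv_eq_zero (fun t ↦ (hF t).differentiableAt) (fun t ↦ (hF t).deriv) t (a + 1)
  have hout : g (a + 1) = 0 :=
    image_eq_zero_of_notMem_tsupport fun h ↦ by linarith [(hga h).2]
  funext t
  have := hconst t
  rw [hout, zero_mul, mul_eq_zero] at this
  rcases this with h | h
  · simpa using h
  · exact absurd h (Complex.exp_ne_zero _)

/-- **Finite sets are invisible.** For every `a > 0` and every finite `S ⊂ ℂ` there is a nonzero
Weil test supported in `[-a, a]` whose transform vanishes on `S`. -/
theorem exists_isWeilTest_weilMellin_eq_zero_on_finset (ha : 0 < a) (S : Finset ℂ) :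
    ∃ g : ℝ → ℂ, IsWeilTest g ∧ tsupport g ⊆ Icc (-a) a ∧ g ≠ 0 ∧
      ∀ z ∈ S, weilMellin g z = 0 := by
  classical
  induction S using Finset.induction with
  | empty =>
      obtain ⟨φ, hφ, hφa, hφ0⟩ := exists_isWeilTest_bump_weilMellin_half_ne_zero ha
      refine ⟨φ, hφ, hφa, ?_, fun z hz ↦ absurd hz (Finset.notMem_empty z)⟩
      rintro rfl
      apply hφ0
      simp [weilMellin]
  | insert z S hzS ih =>
      obtain ⟨g, hg, hga, hg0, hS⟩ := ih
      refine ⟨weilAnnihilate g z, isWeilTest_weilAnnihilate hg z,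
        (tsupport_weilAnnihilate_subset g z).trans hga, weilAnnihilate_ne_zero hg hga hg0 z, ?_⟩
      intro w hw
      rcases Finset.mem_insert.mp hw with rfl | hw
      · exact weilMellin_weilAnnihilate_self hg _
      · rw [weilMellin_weilAnnihilate hg, hS w hw, mul_zero]

/-- **Verified zeros are finite-rank information.** For every window `a > 0` and every height
`T₀` there is a nonzero Weil test supported in `[-a, a]` whose transform vanishes at every zero of
`ζ` in the critical strip of height `< T₀`. -/
theorem exists_isWeilTest_weilMellin_eq_zero_on_zetaZerosBelow (ha : 0 < a) (T₀ : ℝ) :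
    ∃ g : ℝ → ℂ, IsWeilTest g ∧ tsupport g ⊆ Icc (-a) a ∧ g ≠ 0 ∧
      ∀ ρ ∈ zetaZerosBelow T₀, weilMellin g ρ = 0 := by
  obtain ⟨g, hg, hga, hg0, hS⟩ :=
    exists_isWeilTest_weilMellin_eq_zero_on_finset ha (zetaZerosBelow_finite T₀).toFinset
  exact ⟨g, hg, hga, hg0, fun ρ hρ ↦ hS ρ ((zetaZerosBelow_finite T₀).mem_toFinset.mpr hρ)⟩

/-- Consequently every weighted verified zero sum `∑_{ρ verified} m(ρ) |ĝ(ρ)|²` has a nonzero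
window-`a` test in its kernel, for every window: as a form on the window space it is positive of
finite rank and its infimum over unit tests is not positive. -/
theorem verified_zero_sum_eq_zero (ha : 0 < a) (T₀ : ℝ) (m : ℂ → ℝ) :
    ∃ g : ℝ → ℂ, IsWeilTest g ∧ tsupport g ⊆ Icc (-a) a ∧ g ≠ 0 ∧
      ∑ ρ ∈ (zetaZerosBelow_finite T₀).toFinset, m ρ * ‖weilMellin g ρ‖ ^ 2 = 0 := by
  obtain ⟨g, hg, hga, hg0, hS⟩ := exists_isWeilTest_weilMellin_eq_zero_on_zetaZerosBelow ha T₀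
  refine ⟨g, hg, hga, hg0, Finset.sum_eq_zero fun ρ hρ ↦ ?_⟩
  rw [hS ρ ((zetaZerosBelow_finite T₀).mem_toFinset.mp hρ), norm_zero, zero_pow two_ne_zero,
    mul_zero]

end Summit.RiemannHypothesis.RiemannHypothesis.Theorems
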